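import Summits.CriticalPhenomena.Ising3DConformalLimit.Theorems.HarmonicMomentsIsotropyTwoPointAsymptoticIsotropyOfRayRV
import Summits.CriticalPhenomena.Ising3DConformalLimit.Theorems.EnergyNotSigmaSquaredMoebiusLimitExistsPinnedTwoPoint
import Summits.CriticalPhenomena.Ising3DConformalLimit.Theorems.BernsteinTemperatureKernelTransferStep
import Summits.CriticalPhenomena.Ising3DConformalLimit.Theorems.PrecisionLaplacianTwoPointSpineGlueLattice
import HarnessLib

/-!
# Crux `IsingEuclidUpgradeR2RotInvPowerLaw` (stmt-CriticalPhenomena-0634), line `tower_profile_rigidity`: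
# stub Rray `stub_rayRigidityTransfer` — the ray dilation law forces RATIO ISOTROPY

Write `G := criticalTwoPoint 3` for the critical two-point function `⟨σ₀σ_x⟩_{β_c}` of the
nearest-neighbour Ising model on `ℤ³`, `g(n) := G(n e₀)` and `|x|₂ := √(∑ xᵢ²)`.

**Theorem** (`stub_rayRigidityTransfer`, the registered stub Rray of variant Q of the line, verbatim).
For every `Δ`: if along EVERY lattice ray `ℤv`, `v ≠ 0`, the integer dilation law
`G(knv)·k^{2Δ}/G(nv) → 1` (`n → ∞`) holds for every `k ≥ 1` (and — an unused extra hypothesis of the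
registered signature — the uniform axis dilation law on windows `[b, 2b]` holds), then
`G(x)/g(⌊|x|₂⌋) → 1` cofinitely on `ℤ³` (ratio isotropy S3).

Proof. The ray law is ray regular variation `RayRV[2Δ]` of the tree
(`G(kmx)/G(mx) → k^{-2Δ}`); by the LANDED theorem
`HarmonicMomentsIsotropyTwoPoint.RayRV.pairLimit_of_rayRV` (doubling ⇒ uniform regularity ⇒ cluster
points of the pinned pair zoom ⇒ homogeneous nine-mirror-RP cluster kernels ⇒ `HRP2Rigidity_of` ⇒
uniqueness) the pinned pair zoom `ρ_pin(δ)² ⟨σ_{[z₀/δ]}σ_{[z₁/δ]}⟩_{β_c}` converges to `‖z₁ − z₀‖^{-2Δ}`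
locally uniformly on non-coincident pairs as `δ → 0⁺`. At the mesh `δ = 1/n`, `n := ⌊|x|₂⌋`, and the
pair `(0, x/n)` — whose second point lies in the compact shell `1 ≤ ‖y‖ ≤ 2` — the pinned pair zoom IS
`G(x)/g(n)` (`ρ_pin(1/n)² = 1/g(n)`), so uniform convergence on that shell gives
`G(x)/g(n) − (|x|₂/n)^{-2Δ} → 0` cofinitely, and `(|x|₂/n)^{-2Δ} → 1`.

References: H. Duminil-Copin, ICM 2022, §8.1 (rotation invariance of the critical two-point function
on `ℤ³` is postulated) [DuminilCopinICM2022]; the rigidity input is the tree's `HRP2Rigidity_of`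
(nine-mirror reflection positivity, Fröhlich–Israel–Lieb–Simon 1978) inside `pairLimit_of_rayRV`.
No definitions are introduced.
-/

noncomputable section

namespace Summit.CriticalPhenomena.Ising3DConformalLimit.Cruxes.IsingEuclidUpgradeR2RotInvPowerLaw.TowerProfileRigidity

open Filter Topology Set Literature.Probability.LatticeModels
open Summit.CriticalPhenomena.Ising3DConformalLimit.MoebiusLimitExistsOnlyInteraction (rhoPin rhoPin_sq)
open Summit.CriticalPhenomena.Ising3DConformalLimit.HyperoctahedralRPTwoPoint
  (zero_pair_mem_nonCoincident continuous_zeroPair)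
open Summit.CriticalPhenomena.Ising3DConformalLimit.HarmonicMomentsIsotropyTwoPoint.RayRV
  (pairLimit_of_rayRV rescaledCorrelator_zero_smul_siteVec)
open Summit.CriticalPhenomena.Ising3DConformalLimit.Theorems.KernelTransfer (tendsto_sqrt_sum_sq_cofinite)
open Summit.CriticalPhenomena.Ising3DConformalLimit.Theorems.SpineGlue (norm_siteVec)

/-- The pinned pair zoom at mesh `1/n` and the pair `(0, x/n)` is `G(x)/g(n)`. [folklore] -/
theorem pairZoom_inv_nat (x : Site 3) {n : ℕ} (hn : 1 ≤ n) :
    rescaledCorrelator (criticalCorr 3) rhoPin 2 (1 / (n : ℝ))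
        (![0, (1 / (n : ℝ)) • siteVec x] : Fin 2 → EuclideanSpace ℝ (Fin 3)) =
      criticalTwoPoint 3 x / criticalTwoPoint 3 (Pi.single 0 ((n : ℕ) : ℤ)) := by
  have hn0 : (0 : ℝ) < n := by exact_mod_cast hn
  rw [rescaledCorrelator_zero_smul_siteVec rhoPin (by positivity) x, rhoPin_sq, one_div_one_div,
    Int.floor_natCast]
  rw [inv_mul_eq_div]

/-- **Pointwise ratio isotropy from ray regular variation.** If `G(kmx)/G(mx) → k^{-a}` along every
lattice ray, then `G(x)/g(⌊|x|₂⌋) → 1` cofinitely. [cite: DuminilCopinICM2022, §8.1] -/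
theorem ratioIsotropy_of_rayRV {a : ℝ}
    (hRV : ∀ x : Site 3, x ≠ 0 → ∀ k : ℕ, 1 ≤ k →
      Tendsto (fun m : ℕ => criticalTwoPoint 3 (fun i => ((k * m : ℕ) : ℤ) * x i) /
        criticalTwoPoint 3 (fun i => ((m : ℕ) : ℤ) * x i)) atTop (𝓝 ((k : ℝ) ^ (-a)))) :
    Tendsto (fun x : Site 3 => criticalTwoPoint 3 x /
      criticalTwoPoint 3 (Pi.single 0 ((⌊Real.sqrt (∑ i, ((x i : ℝ)) ^ 2)⌋₊ : ℕ) : ℤ)))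
      cofinite (𝓝 1) := by
  have hPL := pairLimit_of_rayRV hRV
  -- notation
  set E : Site 3 → ℝ := fun x => Real.sqrt (∑ i, ((x i : ℝ)) ^ 2) with hE
  set N : Site 3 → ℕ := fun x => ⌊E x⌋₊ with hN
  set g : ℕ → ℝ := fun n => criticalTwoPoint 3 (Pi.single 0 ((n : ℕ) : ℤ)) with hg
  have hE_top : Tendsto E cofinite atTop := tendsto_sqrt_sum_sq_cofinite 3
  have hN_top : Tendsto N cofinite atTop := tendsto_nat_floor_atTop.comp hE_top
  -- the compact shell `K = {(0, y) : 1 ≤ ‖y‖ ≤ 2}` inside the non-coincident pairs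
  set A : Set (EuclideanSpace ℝ (Fin 3)) := {y | 1 ≤ ‖y‖ ∧ ‖y‖ ≤ 2} with hA
  set K : Set (Fin 2 → EuclideanSpace ℝ (Fin 3)) :=
    (fun y : EuclideanSpace ℝ (Fin 3) => (![0, y] : Fin 2 → EuclideanSpace ℝ (Fin 3))) '' A with hK
  have hAc : IsCompact A := by
    have h1 : A = Metric.closedBall (0 : EuclideanSpace ℝ (Fin 3)) 2 ∩ {y | 1 ≤ ‖y‖} := by
      ext y
      simp only [hA, Set.mem_setOf_eq, Set.mem_inter_iff, Metric.mem_closedBall, dist_zero_right]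
      tauto
    rw [h1]
    exact (isCompact_closedBall _ _).inter_right (isClosed_le continuous_const continuous_norm)
  have hKc : IsCompact K := hAc.image continuous_zeroPair
  have hKsub : K ⊆ NonCoincident 3 2 := by
    rintro _ ⟨y, hy, rfl⟩
    refine zero_pair_mem_nonCoincident ?_
    intro h0
    rw [h0] at hy
    simp only [hA, Set.mem_setOf_eq, norm_zero] at hy
    exact absurd hy.1 (by norm_num)
  -- uniform convergence on `K`
  have hunif := (tendstoLocallyUniformlyOn_iff_forall_isCompact (isOpen_nonCoincident 3 2)).1
    hPL K hKsub hKc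
  rw [Metric.tendstoUniformlyOn_iff] at hunif
  -- the model term `(E x / N x)^{-a} → 1`
  have hC0 : Tendsto (fun x => ((N x : ℕ) : ℝ) / E x) cofinite (𝓝 1) :=
    (tendsto_nat_floor_div_atTop (R := ℝ)).comp hE_top
  have hC1 : Tendsto (fun x => E x / ((N x : ℕ) : ℝ)) cofinite (𝓝 1) := by
    have h := hC0.inv₀ one_ne_zero
    rw [inv_one] at h
    refine h.congr fun x => ?_
    simp only [inv_div]
  have hC : Tendsto (fun x => (E x / ((N x : ℕ) : ℝ)) ^ (-a)) cofinite (𝓝 1) := by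
    have h := hC1.rpow_const (p := -a) (Or.inl one_ne_zero)
    simpa using h
  -- the defect `G x / g (N x) − (E x / N x)^{-a} → 0`
  have hD : Tendsto (fun x => criticalTwoPoint 3 x / g (N x) - (E x / ((N x : ℕ) : ℝ)) ^ (-a))
      cofinite (𝓝 0) := by
    rw [Metric.tendsto_nhds]
    intro ε hε
    obtain ⟨u, hu, hK⟩ := ((nhdsGT_basis (0 : ℝ)).eventually_iff).1 (hunif ε hε)
    -- eventually `N x ≥ 1` and `1 / N x < u`
    obtain ⟨n₀, hn₀⟩ := exists_nat_gt (1 / u)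
    filter_upwards [hN_top.eventually (eventually_ge_atTop (max n₀ 1))] with x hx
    have hN1 : 1 ≤ N x := le_trans (le_max_right _ _) hx
    have hNn₀ : n₀ ≤ N x := le_trans (le_max_left _ _) hx
    have hNpos : (0 : ℝ) < ((N x : ℕ) : ℝ) := by exact_mod_cast hN1
    have hδ : (1 / ((N x : ℕ) : ℝ)) ∈ Set.Ioo (0 : ℝ) u := by
      refine ⟨by positivity, ?_⟩
      rw [div_lt_iff₀ hNpos]
      have h1 : (1 : ℝ) / u < n₀ := hn₀
      have h2 : (n₀ : ℝ) ≤ ((N x : ℕ) : ℝ) := by exact_mod_cast hNn₀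
      rw [div_lt_iff₀ hu] at h1
      nlinarith
    -- the pair `(0, x / N x)` lies in `K`
    have hEN : 1 ≤ E x / ((N x : ℕ) : ℝ) ∧ E x / ((N x : ℕ) : ℝ) ≤ 2 := by
      have hfl : ((N x : ℕ) : ℝ) ≤ E x := Nat.floor_le (Real.sqrt_nonneg _)
      have hlt : E x < ((N x : ℕ) : ℝ) + 1 := Nat.lt_floor_add_one (E x)
      constructor
      · rwa [le_div_iff₀ hNpos, one_mul]
      · rw [div_le_iff₀ hNpos]
        have h1 : (1 : ℝ) ≤ ((N x : ℕ) : ℝ) := by exact_mod_cast hN1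
        linarith
    have hmem : (![0, (1 / ((N x : ℕ) : ℝ)) • siteVec x] : Fin 2 → EuclideanSpace ℝ (Fin 3)) ∈ K := by
      refine ⟨(1 / ((N x : ℕ) : ℝ)) • siteVec x, ?_, rfl⟩
      simp only [hA, Set.mem_setOf_eq]
      rw [norm_smul, Real.norm_eq_abs, abs_of_pos (by positivity : (0 : ℝ) < 1 / ((N x : ℕ) : ℝ)),
        norm_siteVec, one_div_mul_eq_div]
      exact hEN
    have h := hK hδ _ hmem
    rw [pairZoom_inv_nat x hN1] at h
    rw [Real.dist_eq, sub_zero]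
    rw [Real.dist_eq] at h
    -- `‖z 1 − z 0‖ = E x / N x`
    have hnorm : ‖((![0, (1 / ((N x : ℕ) : ℝ)) • siteVec x] : Fin 2 → EuclideanSpace ℝ (Fin 3)) 1) -
        ((![0, (1 / ((N x : ℕ) : ℝ)) • siteVec x] : Fin 2 → EuclideanSpace ℝ (Fin 3)) 0)‖ =
        E x / ((N x : ℕ) : ℝ) := by
      simp only [Matrix.cons_val_one, Matrix.cons_val_zero, sub_zero]
      rw [norm_smul, Real.norm_eq_abs, abs_of_pos (by positivity : (0 : ℝ) < 1 / ((N x : ℕ) : ℝ)),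
        norm_siteVec, one_div_mul_eq_div]
    rw [hnorm] at h
    rwa [abs_sub_comm] at h
  -- assemble
  have hsum := hD.add hC
  rw [zero_add] at hsum
  refine hsum.congr fun x => ?_
  simp only [hg]
  ring

/-- **Rray (ray rigidity transfer), the registered stub `stub_rayRigidityTransfer` of line
`tower_profile_rigidity` (variant Q), verbatim.** The ray dilation law at exponent `Δ` (together with
the — here unused — uniform axis dilation law) implies ratio isotropy of the critical two-point function
on `ℤ³`: `⟨σ₀σ_x⟩_{β_c} / ⟨σ₀σ_{⌊|x|₂⌋e₀}⟩_{β_c} → 1` cofinitely. Rotation invariance of the critical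
two-point function at the ratio level is thus implied by ray-wise scale covariance, via nine-mirror
reflection-positivity rigidity (`pairLimit_of_rayRV`, `HRP2Rigidity_of`). [cite: DuminilCopinICM2022, §8.1] -/
theorem stub_rayRigidityTransfer :
    ∀ Δ : ℝ, (∀ v : Literature.Probability.LatticeModels.Site 3, v ≠ 0 → ∀ k : ℕ, 1 ≤ k → Filter.Tendsto (fun n : ℕ => Literature.Probability.LatticeModels.criticalTwoPoint 3 (((k * n : ℕ) : ℤ) • v) * (k : ℝ) ^ (2 * Δ) / Literature.Probability.LatticeModels.criticalTwoPoint 3 (((n : ℕ) : ℤ) • v)) Filter.atTop (nhds 1)) → (∀ b m : ℕ → ℕ, Filter.Tendsto b Filter.atTop Filter.atTop → (∀ᶠ i in Filter.atTop, b i ≤ m i ∧ m i ≤ 2 * b i) → Filter.Tendsto (fun i : ℕ => Literature.Probability.LatticeModels.criticalTwoPoint 3 (Pi.single 0 ((m i : ℕ) : ℤ)) * ((m i : ℝ) / (b i : ℝ)) ^ (2 * Δ) / Literature.Probability.LatticeModels.criticalTwoPoint 3 (Pi.single 0 ((b i : ℕ) : ℤ))) Filter.atTop (nhds 1)) → Filter.Tendsto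 (fun x : Literature.Probability.LatticeModels.Site 3 => Literature.Probability.LatticeModels.criticalTwoPoint 3 x / Literature.Probability.LatticeModels.criticalTwoPoint 3 (Pi.single 0 ((⌊Real.sqrt (∑ i, ((x i : ℝ)) ^ 2)⌋₊ : ℕ) : ℤ))) Filter.cofinite (nhds 1) := by
  intro Δ hray _hU
  refine ratioIsotropy_of_rayRV (a := 2 * Δ) fun x hx k hk => ?_
  have hk0 : (0 : ℝ) < k := by exact_mod_cast hk
  have hkr : (k : ℝ) ^ (2 * Δ) ≠ 0 := (Real.rpow_pos_of_pos hk0 _).ne'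
  have h := (hray x hx k hk).mul_const ((k : ℝ) ^ (-(2 * Δ)))
  rw [one_mul] at h
  refine h.congr fun n => ?_
  have e1 : ((((k * n : ℕ) : ℤ) • x : Site 3)) = fun i => ((k * n : ℕ) : ℤ) * x i := by
    funext i
    simp [Pi.smul_apply]
  have e2 : ((((n : ℕ) : ℤ) • x : Site 3)) = fun i => ((n : ℕ) : ℤ) * x i := by
    funext i
    simp [Pi.smul_apply]
  rw [e1, e2, Real.rpow_neg hk0.le]
  field_simp

end Summit.CriticalPhenomena.Ising3DConformalLimit.Cruxes.IsingEuclidUpgradeR2RotInvPowerLaw.TowerProfileRigidity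

end
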